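import Mathlib
import Summits.Ventures.HodgeRepro2.T5PropGSkeleton
import Summits.Ventures.HodgeRepro2.T5FiniteZerosCharacters

/-!
# T5PropGBranchMeasure — the branch data of a measure on `ℤ_p`, and S5 as the skeleton's `FinitelyManyZeros`

Cell pub-hodge-repro2, Tier 5 support (seat p7; route/T5-CHECK-G-p7.md §3 S5, §7(b)). The logical
skeleton T5PropGSkeleton (p390598) takes «branch data» `d : BranchData Ξ W` — `d.m ν = ∫ν dm`,
`d.L ν = L(1, λν)`, `d.inv ν = ν⁻¹` — and derives Proposition G's (i)–(iii) from the named Props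
`FinitelyManyZeros d` (= S1–S5), `InterpolationTransfer d` (= S6 + 2(c)) and `SignConstant` (= S8).
Here the first of these is DISCHARGED for the cell's measure model: with `Ξ` = the continuous characters
of `Γ_𝔭 ≅ ℤ_p`, `m` a continuous `R`-linear functional on `C(ℤ_p, R)` and any `L : Ξ → ℂ`,

* `branchData m L : BranchData Ξ R` (`m`-component `ν ↦ ∫ν dm`, `inv` = `ν ↦ ν(−·)`, an involution:
  `negAddChar`, `negEquiv`);
* `finitelyManyZeros_branchData`: `FinitelyManyZeros (branchData m L)` whenever `m ≠ 0`
  (T5FiniteZerosCharacters = p8's Weierstrass + the Amice transform + `ν ↦ ν(1) − 1` injective);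
* `cofiniteNonvanishing_of_transfer`: hence `CofiniteNonvanishing (branchData m L)` — Proposition G (i)
  for this branch — as soon as the interpolation transfer S6 holds for `L`.

`InterpolationTransfer` (the interpolation formula [P1](1.1) and 2(c)) and `SignConstant` (S8) stay the
named hypotheses they were. Mathlib + own files + T5PropGSkeleton + p8's T5FiniteZeros.
-/

namespace Summit.Ventures.HodgeRepro2.T5PropGBranchMeasure

open PadicInt Filter Topology
open Summit.Ventures.HodgeRepro2
open Summit.Ventures.HodgeRepro2.T5PropGSkeleton

variable {p : ℕ} [hp : Fact p.Prime]

section Monoid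

variable {R : Type*} [Monoid R] [TopologicalSpace R]

/-- The inverse character `ν⁻¹ : x ↦ ν(−x)` of an additive character of `ℤ_p`. -/
noncomputable def negAddChar (κ : AddChar ℤ_[p] R) : AddChar ℤ_[p] R :=
  κ.compAddMonoidHom (-AddMonoidHom.id ℤ_[p])

omit [TopologicalSpace R] in
/-- `negAddChar κ x = κ (−x)`. -/
@[simp] theorem negAddChar_apply (κ : AddChar ℤ_[p] R) (x : ℤ_[p]) : negAddChar κ x = κ (-x) := rfl

omit [TopologicalSpace R] in
/-- `ν ↦ ν⁻¹` is an involution. -/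
@[simp] theorem negAddChar_negAddChar (κ : AddChar ℤ_[p] R) : negAddChar (negAddChar κ) = κ := by
  ext x
  simp

/-- `ν⁻¹` is continuous when `ν` is. -/
theorem continuous_negAddChar {κ : AddChar ℤ_[p] R} (hκ : Continuous κ) :
    Continuous (negAddChar κ) :=
  hκ.comp continuous_neg

/-- `ν ↦ ν⁻¹` as a bijection of the continuous characters of `ℤ_p` (the `inv` of the branch data). -/
noncomputable def negEquiv : {κ : AddChar ℤ_[p] R // Continuous κ} ≃ {κ : AddChar ℤ_[p] R // Continuous κ} where
  toFun κ := ⟨negAddChar κ.1, continuous_negAddChar κ.2⟩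
  invFun κ := ⟨negAddChar κ.1, continuous_negAddChar κ.2⟩
  left_inv κ := by
    apply Subtype.ext
    exact negAddChar_negAddChar κ.1
  right_inv κ := by
    apply Subtype.ext
    exact negAddChar_negAddChar κ.1

/-- `negEquiv κ = ν ↦ ν(−·)`. -/
@[simp] theorem negEquiv_apply (κ : {κ : AddChar ℤ_[p] R // Continuous κ}) (x : ℤ_[p]) :
    (negEquiv κ).1 x = κ.1 (-x) := rfl

end Monoid

section Measure

variable {R : Type*} [NormedCommRing R] [Algebra ℤ_[p] R] [IsBoundedSMul ℤ_[p] R]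
  [IsUltrametricDist R]

/-- THE BRANCH DATA OF A MEASURE: `Ξ` = the continuous characters of `ℤ_p`, `m`-component
`ν ↦ ∫ν dm`, `inv` = `ν ↦ ν⁻¹`, and an arbitrary `L : Ξ → ℂ` (the L-values `ν ↦ L(1, λν)`). -/
noncomputable def branchData (m : C(ℤ_[p], R) →ₗ[R] R)
    (L : {κ : AddChar ℤ_[p] R // Continuous κ} → ℂ) :
    BranchData {κ : AddChar ℤ_[p] R // Continuous κ} R where
  L := L
  m := fun κ => m ⟨κ.1, κ.2⟩
  inv := negEquiv

omit [Algebra ℤ_[p] R] [IsBoundedSMul ℤ_[p] R] [IsUltrametricDist R] in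
/-- The `m`-component of the branch data is `∫ν dm`. -/
@[simp] theorem branchData_m (m : C(ℤ_[p], R) →ₗ[R] R)
    (L : {κ : AddChar ℤ_[p] R // Continuous κ} → ℂ) (κ : {κ : AddChar ℤ_[p] R // Continuous κ}) :
    (branchData m L).m κ = m ⟨κ.1, κ.2⟩ := rfl

omit [Algebra ℤ_[p] R] [IsBoundedSMul ℤ_[p] R] [IsUltrametricDist R] in
/-- The `L`-component of the branch data is the given `L`. -/
@[simp] theorem branchData_L (m : C(ℤ_[p], R) →ₗ[R] R)
    (L : {κ : AddChar ℤ_[p] R // Continuous κ} → ℂ) (κ : {κ : AddChar ℤ_[p] R // Continuous κ}) :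
    (branchData m L).L κ = L κ := rfl

variable [CompleteSpace R] [IsLinearTopology R R] [IsDomain R] [IsDiscreteValuationRing R]
  [IsAdicComplete (IsLocalRing.maximalIdeal R) R]

/-- S1–S5 DISCHARGED for the measure model: the branch data of a non-zero continuous functional `m`
has finitely many zeros (`FinitelyManyZeros`), the skeleton's first named hypothesis. -/
theorem finitelyManyZeros_branchData (m : C(ℤ_[p], R) →ₗ[R] R) (hm : Continuous m) (hne : m ≠ 0)
    (L : {κ : AddChar ℤ_[p] R // Continuous κ} → ℂ) :
    FinitelyManyZeros (branchData m L) :=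
  T5FiniteZerosCharacters.finite_zeroSet_addChar m hm hne

/-- Proposition G (i) for the branch: `L` vanishes at only finitely many characters, given the
interpolation transfer S6 (`∫ν dm ≠ 0 → L(ν⁻¹) ≠ 0`) for a non-zero `m`. -/
theorem cofiniteNonvanishing_of_transfer (m : C(ℤ_[p], R) →ₗ[R] R) (hm : Continuous m) (hne : m ≠ 0)
    (L : {κ : AddChar ℤ_[p] R // Continuous κ} → ℂ)
    (htr : InterpolationTransfer (branchData m L)) :
    CofiniteNonvanishing (branchData m L) :=
  cofinite_of_finitelyManyZeros_of_transfer _ (finitelyManyZeros_branchData m hm hne L) htr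

/-- The number of zeros of `L` is at most the number of characters killed by `m` (the skeleton's
`ncard_zeroSet_le`, now with its first hypothesis discharged). -/
theorem ncard_zeroSet_L_le (m : C(ℤ_[p], R) →ₗ[R] R) (hm : Continuous m) (hne : m ≠ 0)
    (L : {κ : AddChar ℤ_[p] R // Continuous κ} → ℂ)
    (htr : InterpolationTransfer (branchData m L)) :
    {κ : {κ : AddChar ℤ_[p] R // Continuous κ} | L κ = 0}.ncard ≤
      {κ : {κ : AddChar ℤ_[p] R // Continuous κ} | m ⟨κ.1, κ.2⟩ = 0}.ncard :=
  ncard_zeroSet_le _ (finitelyManyZeros_branchData m hm hne L) htr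

end Measure

end Summit.Ventures.HodgeRepro2.T5PropGBranchMeasure
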